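import Summits.ResolutionOfSingularities.ResolutionOfSingularities.Theorems.HilbertSamuelEliminationSigmaMaxModificationsCorridor3SigmaSurfaceBadness
import Summits.ResolutionOfSingularities.ResolutionOfSingularities.Theorems.HilbertSamuelEliminationSigmaMaxModificationsCorridor3SigmaSurfaceReadyOfSnc
import Summits.ResolutionOfSingularities.ResolutionOfSingularities.Theorems.HilbertSamuelEliminationSigmaMaxModificationsCorridor3SigmaSurfaceTraceSetNowhereDense
import Literature.AlgebraicGeometry.Resolution.CartierDivisorReduced
import Literature.AlgebraicGeometry.Resolution.KollarOrderReduction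
import Literature.AlgebraicGeometry.Resolution.KollarBlowupSequenceFunctors
import Literature.AlgebraicGeometry.Resolution.ExceptionalPointsFinite
import Literature.AlgebraicGeometry.Resolution.BlowupDimension
import HarnessLib

/-!
# [OURS · L1 W4.2] σ-LAYER PHASE B′ — `Corridor3SigmaSurfaceBadnessZero`: **`M = 0` DELIVERS THE READINESS SIDE CONDITIONS** — on a regular integral Noetherian
# carrier with locally principal non-zero traces, `badness = 0` makes every trace stalk a PRIME principal ideal on its support and distinct traces stalk-distinct;
# hence THE CONVERSE (R-a) OF RECORD: «`D̃` regular ∧ `ℓ(E, D) = 0` ∧ `M(E, D) = 0` ∧ no repeated trace ⇒ `ReadyTSOfRecord`»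
# (RULING v3.14-43 (KN) «stub-1 TYPES the converse»; composes this seat's p551893 `readyTSOfRecord_of_surfaceSncLength_eq_zero` with the count of record
# `badOfRecord` (`…Corridor3SigmaSurfaceBadness`); crux chain w42 `SigmaMaxModifications` stmt-ResolutionOfSingularities-18506 / conjunct
# `SigmaMaxModificationsCorridor3` stmt-ResolutionOfSingularities-19249; helper of res-L1-w42-stub-1 (gen 6), `--supports stmt-…-19249 --as helper`, counted 0)

HONEST FRAMING. OURS bookkeeping over the tree's Cossart–Piltant divisorial dictionary (`divisorialPart_eq_self_of_isLocallyPrincipal`,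
`exists_primes_stalkIdeal_divisorialPart_eq'`: a non-zero locally principal ideal on a regular integral Noetherian scheme has stalk `(∏_{ζ ⤳ x} q_ζ^{ord_ζ})` with
pairwise non-associated primes `q_ζ` presenting the codimension-one components through `x`), Literature `stalkIdeal_map_stalkSpecializes` (Stacks 01J7),
`finite_setOf_mem_and_coheight_eq_one`, `maxPoints_finite`, `topologicalKrullDim_le_iff_forall_coheight_le`, and p551893. NOTHING here is a statement of
H. Hironaka's manuscript [Hironaka2017] nor of [CossartJannsenSaito2020]; no named fact. AI-written; AI review is weaker than expert review.

THE ARGUMENT. `M = 0` reads (p-file `…SurfaceBadness`, `badness_eq_zero_iff`): every codimension-one point `ζ` of the configuration carries exactly ONE member, of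
order ONE, and no member has two codimension-one components through a common point. So at `x ∈ supp Γ` the divisorial presentation `Γ_x = (∏ q_ζ^{ord_ζ Γ})` has a
single factor to the first power: `Γ_x = (q)` PRIME, and `(q) = 𝔭_ζ` is the prime of the component; were `Γ'_x = Γ_x` for another member `Γ'`, then
`Γ'_x ≤ 𝔭_ζ` puts `ζ` on `supp Γ'` — two members through `ζ`, excluded. Finiteness of the index sets: codimension-one points of a proper closed subset of a
Noetherian integral scheme are finitely many; on a surface (`coheight ≤ 2`) two distinct codimension-one components meet in a closed set of codimension-two
points, which are pairwise non-specialising, hence all maximal, hence finitely many.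

## Contents (namespace `…Theorems.SigmaMaxModificationsCorridor3.Sigma`)

* `mem_support_iff_stalkIdeal_le_primeOfSpecializes` (`ζ ⤳ x`: `ζ ∈ supp I ↔ I_x ≤ 𝔭_ζ`); `exists_prime_stalkIdeal_eq_span_of_divisorial` (one member: order one at
  its codimension-one points over `x` + at most one such point ⇒ `Γ_x = (q) = 𝔭_ζ`, `q` prime).
* `Boundary.codimOnePoints_finite`, `Boundary.finite_setOf_specializes_of_coheight` / **`Boundary.crossingPts_finite_of_coheight_le_two`** (surfaces).
* **`Boundary.exists_prime_stalkIdeal_eq_span_of_badness_eq_zero`** (`hprin`) and **`Boundary.stalkIdeal_ne_of_badness_eq_zero`** (`hdist`).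
* **`readyTSOfRecord_of_badOfRecord_eq_zero`** — THE CONVERSE (R-a): irreducible `D` with Noetherian regular reduced surface `D̃` of dimension `≤ 2`, boundary
  members locally principal, no repeated trace, some resolving composition, `ℓ(E, D) = 0`, `M(E, D) = 0` ⇒ `ReadyTSOfRecord W E N ν D`; and the ℓ-gated form
  `readyTSOfRecord_of_badGatedOfRecord_eq_zero` (`bad' = 0 ∧ ℓ = 0`).

VACUITY SELF-CHECK. The hypotheses are those of the regular-surface phase of (P1*) (`Sigma.MembersLocallyPrincipal` is o1's run invariant p552583 §4, propagated
by res-D-pv-060's `isLocallyPrincipal_principalStrictTransform`); `M = 0 ∧ ℓ = 0` is inhabited (e.g. one member with a regular reduced trace), and the DESIGN-CHECK-1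
witness `V(xy)` has `M = 2`, correctly outside.
-/

noncomputable section

set_option linter.dupNamespace false -- mandated namespace of this single-conjunct summit

open CategoryTheory AlgebraicGeometry TopologicalSpace IsLocalRing
open Summit.ResolutionOfSingularities.ResolutionOfSingularities.Theorems.CampaignW42
open Literature.AlgebraicGeometry.Resolution Literature.RingTheory.HilbertSamuel

namespace Summit.ResolutionOfSingularities.ResolutionOfSingularities.Theorems.SigmaMaxModificationsCorridor3.Sigma

universe u

open Scheme.IdealSheafData

/-! ## One locally principal member: the divisorial presentation with a single reduced factor -/

section OneMember

variable {D : Scheme.{u}}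

/-- **`ζ ∈ supp I ↔ I_x ≤ 𝔭_ζ`** for a generisation `ζ ⤳ x` (`I_ζ = I_x 𝒪_{D,ζ}` and `𝔭_ζ = (𝒪_x → 𝒪_ζ)⁻¹ 𝔪_ζ`). [cite: StacksProject, Tag 01J7] -/
theorem mem_support_iff_stalkIdeal_le_primeOfSpecializes (I : D.IdealSheafData) {ζ x : D} (h : ζ ⤳ x) :
    ζ ∈ I.support ↔ stalkIdeal I x ≤ primeOfSpecializes h := by
  rw [mem_support_iff_stalkIdeal_le, ← stalkIdeal_map_stalkSpecializes I h, Ideal.map_le_iff_le_comap]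

/-- **ONE MEMBER**: on a regular integral Noetherian scheme let `Γ ≠ 0` be locally principal, of order ONE at each of its codimension-one points specialising to `x`,
with AT MOST ONE such point; if `x ∈ supp Γ` then `Γ_x = (q)` for a PRIME `q`, and `(q) = 𝔭_ζ` is the prime of that codimension-one point `ζ ⤳ x`
(divisorial presentation `Γ_x = (∏_{ζ ⤳ x} q_ζ^{ord_ζ Γ})`). [folklore] -/
theorem exists_prime_stalkIdeal_eq_span_of_divisorial [IsIntegral D] [IsNoetherian D] (hreg : Scheme.IsRegular D) {Γ : D.IdealSheafData} (hΓ0 : Γ ≠ ⊥)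
    (hlp : IsLocallyPrincipal Γ) {x : D} (hx : x ∈ Γ.support) (hord : ∀ ζ ∈ divisorialPoints Γ, ζ ⤳ x → idealOrder Γ ζ = 1)
    (hone : ∀ ζ₁ ∈ divisorialPoints Γ, ∀ ζ₂ ∈ divisorialPoints Γ, ζ₁ ⤳ x → ζ₂ ⤳ x → ζ₁ = ζ₂) :
    ∃ ζ ∈ divisorialPoints Γ, ∃ h : ζ ⤳ x, ∃ q : D.presheaf.stalk x, Prime q ∧ stalkIdeal Γ x = Ideal.span {q} ∧ primeOfSpecializes h = Ideal.span {q} := by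
  classical
  obtain ⟨T, q, hT, hT', hqprime, hq1, hqst, hH⟩ := exists_primes_stalkIdeal_divisorialPart_eq' hreg hΓ0 x
  rw [divisorialPart_eq_self_of_isLocallyPrincipal hreg hΓ0 hlp] at hH
  -- some codimension-one point of `supp Γ` specialises to `x` (else `Γ_x = (1)`)
  obtain ⟨ζ₀, hζ₀T, hζ₀x⟩ : ∃ ζ₀ ∈ T, ζ₀ ⤳ x := by
    by_contra hnone
    simp only [not_exists, not_and] at hnone
    have h1 : ∏ ζ ∈ T, q ζ ^ (idealOrder Γ ζ).toNat = 1 :=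
      Finset.prod_eq_one fun ζ hζ => by rw [hq1 ζ hζ (hnone ζ hζ), one_pow]
    rw [h1, Ideal.span_singleton_one] at hH
    rw [mem_support_iff_stalkIdeal_le, hH, top_le_iff] at hx
    exact (maximalIdeal.isMaximal _).ne_top hx
  have hζ₀ : ζ₀ ∈ divisorialPoints Γ := hT ζ₀ hζ₀T
  -- it is the only factor
  have hprod : ∏ ζ ∈ T, q ζ ^ (idealOrder Γ ζ).toNat = q ζ₀ := by
    rw [Finset.prod_eq_single ζ₀]
    · rw [hord ζ₀ hζ₀ hζ₀x]
      simp
    · intro ζ hζ hne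
      by_cases hζx : ζ ⤳ x
      · exact absurd (hone ζ (hT ζ hζ) ζ₀ hζ₀ hζx hζ₀x) hne
      · rw [hq1 ζ hζ hζx, one_pow]
    · exact fun h => absurd hζ₀T h
  rw [hprod] at hH
  refine ⟨ζ₀, hζ₀, hζ₀x, q ζ₀, hqprime ζ₀ hζ₀T hζ₀x, hH, ?_⟩
  rw [← stalkIdeal_primeDivisorIdeal hζ₀x, hqst ζ₀ hζ₀T]

end OneMember

/-! ## Finiteness of the index sets -/

section Finite

variable {D : Scheme.{u}} {Γs : Boundary D}

/-- **The codimension-one points of the configuration are finitely many** on a Noetherian integral scheme, when no member vanishes (Stacks 0BE1). [folklore] -/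
theorem Boundary.codimOnePoints_finite [IsIntegral D] [IsNoetherian D] (hne : ∀ Γ ∈ Γs, Γ ≠ ⊥) : Γs.codimOnePoints.Finite := by
  refine finite_setOf_mem_and_coheight_eq_one (Boundary.isClosed_divisorSet Γs) fun hgen => ?_
  obtain ⟨Γ, hΓ, hg⟩ := Boundary.mem_divisorSet_iff.mp hgen
  exact not_mem_support_genericPoint (hne Γ hΓ) hg

/-- **Two distinct codimension-one points of a surface have finitely many common specialisations**: on a Noetherian scheme all of whose points have codimension
`≤ 2`, the common specialisations of `ζ₁ ≠ ζ₂` (both of codimension one) have codimension two, are pairwise non-specialising, hence are the maximal points of the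
closed set `cl{ζ₁} ∩ cl{ζ₂}` — finitely many. [folklore] -/
theorem finite_setOf_specializes_of_coheight_le_two [IsNoetherian D] (h2 : ∀ x : D, Order.coheight x ≤ 2) {ζ₁ ζ₂ : D} (h₁ : Order.coheight ζ₁ = 1)
    (h₂ : Order.coheight ζ₂ = 1) (hne : ζ₁ ≠ ζ₂) : {x : D | ζ₁ ⤳ x ∧ ζ₂ ⤳ x}.Finite := by
  set P : Set D := {x : D | ζ₁ ⤳ x ∧ ζ₂ ⤳ x} with hP
  have hPc : IsClosed P := by
    have : P = closure {ζ₁} ∩ closure {ζ₂} := by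
      ext x
      simp only [hP, Set.mem_setOf_eq, Set.mem_inter_iff, ← specializes_iff_mem_closure]
    rw [this]
    exact isClosed_closure.inter isClosed_closure
  -- every point of `P` has codimension two
  have hcoh : ∀ x ∈ P, Order.coheight x = 2 := by
    intro x hx
    refine le_antisymm (h2 x) ?_
    have hx1 : x ≠ ζ₁ := by
      rintro rfl
      exact not_specializes_of_coheight_eq_one h₂ h₁ (Ne.symm hne) hx.2
    have hlt : x < ζ₁ := lt_of_le_not_ge (Scheme.le_iff_specializes.mpr hx.1) fun h' =>
      hx1 ((hx.1.antisymm (Scheme.le_iff_specializes.mp h')).eq).symm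
    have := Order.coheight_add_one_le hlt
    rw [h₁] at this
    exact (by norm_num : (2 : ℕ∞) = 1 + 1) ▸ this
  -- hence every point of `P` is maximal in `P`
  have hsub : P ⊆ maxPoints P := by
    intro x hx
    refine ⟨hx, fun x' hx' hs => ?_⟩
    exact eq_of_specializes_of_coheight_le hs (by rw [hcoh x hx]; exact ENat.coe_ne_top 2) (by rw [hcoh x hx, hcoh x' hx'])
  exact (maxPoints_finite hPc).subset hsub

/-- **THE CROSSING SETS ARE FINITE ON A SURFACE**: on a Noetherian integral scheme with all points of codimension `≤ 2`, the crossing set of a non-zero member is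
finite (a finite union, over pairs of its finitely many codimension-one points, of finite sets). [folklore] -/
theorem Boundary.crossingPts_finite_of_coheight_le_two [IsIntegral D] [IsNoetherian D] (h2 : ∀ x : D, Order.coheight x ≤ 2) {Γ : D.IdealSheafData}
    (hΓ0 : Γ ≠ ⊥) : (Γs.crossingPts Γ).Finite := by
  have hfin := finite_divisorialPoints hΓ0
  refine ((hfin.biUnion fun ζ₁ _ => hfin.biUnion fun ζ₂ _ =>
    (show ({x : D | ζ₁ ≠ ζ₂ ∧ ζ₁ ⤳ x ∧ ζ₂ ⤳ x}).Finite from ?_))).subset ?_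
  · by_cases hne : ζ₁ = ζ₂
    · have : {x : D | ζ₁ ≠ ζ₂ ∧ ζ₁ ⤳ x ∧ ζ₂ ⤳ x} = ∅ := by
        ext x; simp [hne]
      rw [this]; exact Set.finite_empty
    · rename_i h₁ h₂
      exact (finite_setOf_specializes_of_coheight_le_two h2 h₁.2 h₂.2 hne).subset fun x hx => hx.2
  · intro x hx
    obtain ⟨⟨ζ₁, h₁, ζ₂, h₂, hne, hs₁, hs₂⟩, -⟩ := hx
    exact Set.mem_biUnion h₁ (Set.mem_biUnion h₂ ⟨hne, hs₁, hs₂⟩)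

/-- `dim D ≤ 2` in the tree's reading (`topologicalKrullDim`) gives codimension `≤ 2` at every point. [folklore] -/
theorem coheight_le_two_of_topologicalKrullDim_le (hdim : topologicalKrullDim D ≤ 2) (x : D) : Order.coheight x ≤ 2 :=
  (topologicalKrullDim_le_iff_forall_coheight_le D 2).mp hdim x

end Finite

/-! ## `M = 0` ⇒ prime principal stalks and stalk-distinct members -/

section Zero

variable {D : Scheme.{u}} [IsIntegral D] [IsNoetherian D] {Γs : Boundary D}

/-- **`M = 0` ⇒ EVERY TRACE STALK IS A PRIME PRINCIPAL IDEAL ON ITS SUPPORT** (`hprin` of p551893): regular integral Noetherian carrier, members locally principal and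
non-zero, finite crossing sets. [folklore] -/
theorem Boundary.exists_prime_stalkIdeal_eq_span_of_badness_eq_zero (hreg : Scheme.IsRegular D) (hlp : ∀ Γ ∈ Γs, IsLocallyPrincipal Γ)
    (hne : ∀ Γ ∈ Γs, Γ ≠ ⊥) (hfinX : ∀ Γ ∈ Γs, (Γs.crossingPts Γ).Finite) (hM : Γs.badness = 0) {Γ : D.IdealSheafData} (hΓ : Γ ∈ Γs) {x : D}
    (hx : x ∈ Γ.support) : ∃ q : D.presheaf.stalk x, Prime q ∧ stalkIdeal Γ x = Ideal.span {q} := by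
  have hfinT := Boundary.codimOnePoints_finite hne
  have hnz : ∀ Γ ∈ Γs, ∀ y : D, stalkIdeal Γ y ≠ ⊥ := fun Γ hΓ y => stalkIdeal_ne_bot_of_ne_bot (hne Γ hΓ) y
  obtain ⟨ζ, -, -, q, hq, hΓx, -⟩ := exists_prime_stalkIdeal_eq_span_of_divisorial hreg (hne Γ hΓ) (hlp Γ hΓ) hx
    (fun ζ hζ _ => Boundary.idealOrder_eq_one_of_compMults_eq_singleton
      (Boundary.compMults_eq_singleton_of_badness_eq_zero hfinT hfinX hnz hM (Boundary.mem_codimOnePoints_of_mem_divisorialPoints hΓ hζ)) hΓ hζ.1)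
    (fun ζ₁ h₁ ζ₂ h₂ hs₁ hs₂ => Boundary.not_two_branches_of_badness_eq_zero hfinT hfinX hnz hM hΓ h₁ h₂ hs₁ hs₂)
  exact ⟨q, hq, hΓx⟩

/-- **`M = 0` ⇒ DISTINCT MEMBERS HAVE DISTINCT STALKS AT COMMON POINTS** (`hdist` of p551893): if `Γ_x = Γ'_x` then the codimension-one component of `Γ` through `x`
(whose prime IS `Γ_x`) lies on `supp Γ'` too — two members through one codimension-one point, which `M = 0` forbids. [folklore] -/
theorem Boundary.stalkIdeal_ne_of_badness_eq_zero (hreg : Scheme.IsRegular D) (hlp : ∀ Γ ∈ Γs, IsLocallyPrincipal Γ) (hne : ∀ Γ ∈ Γs, Γ ≠ ⊥)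
    (hfinX : ∀ Γ ∈ Γs, (Γs.crossingPts Γ).Finite) (hM : Γs.badness = 0) {Γ Γ' : D.IdealSheafData} (hΓ : Γ ∈ Γs) (hΓ' : Γ' ∈ Γs) (hΓΓ' : Γ ≠ Γ') {x : D}
    (hx : x ∈ Γ.support) (_hx' : x ∈ Γ'.support) : stalkIdeal Γ x ≠ stalkIdeal Γ' x := by
  have hfinT := Boundary.codimOnePoints_finite hne
  have hnz : ∀ Γ ∈ Γs, ∀ y : D, stalkIdeal Γ y ≠ ⊥ := fun Γ hΓ y => stalkIdeal_ne_bot_of_ne_bot (hne Γ hΓ) y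
  obtain ⟨ζ, hζ, hζx, q, -, hΓx, hpζ⟩ := exists_prime_stalkIdeal_eq_span_of_divisorial hreg (hne Γ hΓ) (hlp Γ hΓ) hx
    (fun ζ hζ _ => Boundary.idealOrder_eq_one_of_compMults_eq_singleton
      (Boundary.compMults_eq_singleton_of_badness_eq_zero hfinT hfinX hnz hM (Boundary.mem_codimOnePoints_of_mem_divisorialPoints hΓ hζ)) hΓ hζ.1)
    (fun ζ₁ h₁ ζ₂ h₂ hs₁ hs₂ => Boundary.not_two_branches_of_badness_eq_zero hfinT hfinX hnz hM hΓ h₁ h₂ hs₁ hs₂)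
  intro heq
  -- `Γ'_x = Γ_x = 𝔭_ζ`, so `ζ ∈ supp Γ'`
  have hζ' : ζ ∈ Γ'.support := by
    rw [mem_support_iff_stalkIdeal_le_primeOfSpecializes Γ' hζx, hpζ, ← hΓx, heq]
  have h1 := Boundary.compMults_eq_singleton_of_badness_eq_zero hfinT hfinX hnz hM (Boundary.mem_codimOnePoints_of_mem_divisorialPoints hΓ hζ)
  exact hΓΓ' (Boundary.eq_of_compMults_eq_singleton h1 hΓ hΓ' hζ.1 hζ')

end Zero

/-! ## THE CONVERSE (R-a): `ℓ = 0 ∧ M = 0` ⇒ READY-TS -/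

section Surface

variable {W : Scheme.{u}} {E : Boundary W} {N : ℕ} {ν : ℕ → ℕ} {D : Closeds W}

/-- The filtered traces of locally principal members are locally principal. [folklore] -/
theorem isLocallyPrincipal_of_mem_restrictOff {DS : Scheme.{u}} {ι : DS ⟶ W} (hE : ∀ B ∈ E, IsLocallyPrincipal B) :
    ∀ Γ ∈ E.restrictOff ι, IsLocallyPrincipal Γ := by
  intro Γ hΓ
  obtain ⟨I, hI, -, rfl⟩ := Boundary.mem_restrictOff_iff.mp hΓ
  exact (hE I hI).comap ι

/-- The filtered traces are non-zero ideal sheaves (a kept member does not contain the image of `ι`). [folklore] -/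
theorem ne_bot_of_mem_restrictOff {DS : Scheme.{u}} {ι : DS ⟶ W} : ∀ Γ ∈ E.restrictOff ι, Γ ≠ ⊥ := by
  intro Γ hΓ hbot
  obtain ⟨I, -, hI, rfl⟩ := Boundary.mem_restrictOff_iff.mp hΓ
  apply hI
  rintro _ ⟨y, rfl⟩
  have hy : y ∈ ((I.comap ι).support : Set DS) := by
    rw [hbot, Scheme.IdealSheafData.support_bot]
    trivial
  rwa [Boundary.coe_support_comap] at hy

/-- **THE CONVERSE (R-a) OF RECORD: `D̃` REGULAR ∧ `ℓ(E, D) = 0` ∧ `M(E, D) = 0` ∧ NO REPEATED TRACE ⇒ READY-TS.** For an irreducible `D` whose reduced surface `D̃` is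
Noetherian with regular local rings and of dimension `≤ 2`, with locally principal boundary members (o1's `MembersLocallyPrincipal`), the filtered traces pairwise
distinct, some resolving composition (so that `ℓ = 0` reads «`S(E, D)` is snc»), `surfaceSncLength E D = 0` and `badOfRecord W E D = 0` give `ReadyTSOfRecord W E N ν D`
(p551893 with `hprin` / `hdist` DISCHARGED by `M = 0`). This closes the exhaustiveness hole of DESIGN CHECK 1 for the case rule of record. [folklore] -/
theorem readyTSOfRecord_of_badOfRecord_eq_zero [AlgebraicGeometry.IsNoetherian (menuCentre D).subscheme] (hreg : Scheme.IsRegular (menuCentre D).subscheme)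
    (hDirr : IsIrreducible (D : Set W)) (hdim : topologicalKrullDim ↥(menuCentre D).subscheme ≤ 2) (hE : ∀ B ∈ E, IsLocallyPrincipal B)
    (hnodup : (E.restrictOff (menuCentre D).subschemeι).Nodup)
    (hex : ∃ n, ExistsPointCompositionN (surfaceTraceSet E D) (ResolvesToSnc (surfaceTraceSet E D)) n) (hℓ : surfaceSncLength E D = 0)
    (hM : badOfRecord W E D = 0) : ReadyTSOfRecord W E N ν D := by
  haveI : IsIntegral (menuCentre D).subscheme := isIntegral_subscheme_vanishingIdeal D hDirr
  have hlp := isLocallyPrincipal_of_mem_restrictOff (ι := (menuCentre D).subschemeι) hE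
  have hne := ne_bot_of_mem_restrictOff (E := E) (ι := (menuCentre D).subschemeι)
  have h2 := coheight_le_two_of_topologicalKrullDim_le hdim
  have hfinX : ∀ Γ ∈ E.restrictOff (menuCentre D).subschemeι, ((E.restrictOff (menuCentre D).subschemeι).crossingPts Γ).Finite :=
    fun Γ hΓ => Boundary.crossingPts_finite_of_coheight_le_two h2 (hne Γ hΓ)
  rw [badOfRecord_eq] at hM
  exact readyTSOfRecord_of_surfaceSncLength_eq_zero hreg
    (fun Γ hΓ x hx => Boundary.exists_prime_stalkIdeal_eq_span_of_badness_eq_zero hreg hlp hne hfinX hM hΓ hx)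
    (fun Γ hΓ Γ' hΓ' hΓΓ' x hx hx' => Boundary.stalkIdeal_ne_of_badness_eq_zero hreg hlp hne hfinX hM hΓ hΓ' hΓΓ' hx hx') hnodup hex hℓ

/-- **… with the ℓ-GATED count**: `bad'(E, D) = 0` together with `ℓ(E, D) = 0` means `M(E, D) = 0`, so the same conclusion holds — the third branch of
`SurfacePrep.ofRecord regular phaseS badGatedOfRecord cure pointStepOfRecord` is silent only on READY surfaces. [folklore] -/
theorem readyTSOfRecord_of_badGatedOfRecord_eq_zero [AlgebraicGeometry.IsNoetherian (menuCentre D).subscheme]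
    (hreg : Scheme.IsRegular (menuCentre D).subscheme) (hDirr : IsIrreducible (D : Set W)) (hdim : topologicalKrullDim ↥(menuCentre D).subscheme ≤ 2)
    (hE : ∀ B ∈ E, IsLocallyPrincipal B) (hnodup : (E.restrictOff (menuCentre D).subschemeι).Nodup)
    (hex : ∃ n, ExistsPointCompositionN (surfaceTraceSet E D) (ResolvesToSnc (surfaceTraceSet E D)) n) (hℓ : surfaceSncLength E D = 0)
    (hM' : badGatedOfRecord W E D = 0) : ReadyTSOfRecord W E N ν D := by
  have hM : badOfRecord W E D = 0 := by
    rcases (badGatedOfRecord_eq_zero_iff E D).mp hM' with h | h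
    · rw [hℓ] at h; exact absurd h (lt_irrefl 0)
    · exact h
  exact readyTSOfRecord_of_badOfRecord_eq_zero hreg hDirr hdim hE hnodup hex hℓ hM

end Surface

end Summit.ResolutionOfSingularities.ResolutionOfSingularities.Theorems.SigmaMaxModificationsCorridor3.Sigma

end
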